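import Summits.QuantumFields.YangMills.Theses.BalabanUVNodes
import Summits.QuantumFields.YangMills.Theorems.BalabanUVNodesN27AtKernelPinnedReading13CoPHLetters

/-!
# BalabanUVNodes ∕ N27 = binder B5 AT THE RECORD, leaf (Kᴸ′) — K3⁷ `Theses.BalabanUVNodes.SpineGivenEndpointR13SepCoPH` AT A KERNEL-PINNED STAGE-13 RATE READING WITH **EVERY
# U3-KEYED K4 SLOT READ OFF node00-def-W1's FINITE-VOLUME KERNEL LETTERS OF RECORD** (W1-19b `Node00/U3KernelLetters`): `PolLimitsExistOfRecord₁₃` · `WindowedNE9OfRecord₁₃ … κ Λ` ·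
# `WindowedDecayOfRecord₁₃ … 0 1 κ` · `WindowedStepRateOfRecord₁₃ … s κ θ₅ (C₅·θ₅)` ⇒ N22 (dag-n22-w3 p593053), (D4) (dag-n22-w3 windowed ⇒ (5.10) ∘ this seat's g0 p591653), N18 (dag-n18-w1 p594018),
# N17 ELIMINATED (module (Kᴸ) `…N27AtKernelPinnedReading13CoPHLetters` §2 by name at `N = 2`, `Rg :=` the item's guard `θ.ZhUnity F 2 ∧ θ.SlotsNondegenerate₁₃ F 2`, through XXXVIᶜᵒᵖᴴ
# `spine_rec13CCoPHOn_iff_forall_guarded` and `hc := hP.toCore` — the letters twin of leaves (K′) ∕ (Kᴾ′); a route-facing leaf, nothing may import it)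
# (cell `pub-ymgap`, HUMAN RULING D-0062 Track A; director-ym №197 ∕ HUMAN RULING D-0149; width seat `pub-ymgap-dag-n27-w1` gen 2 on NODE n27 (B5 composite);
# `--kind proof --supports stmt-QuantumFields-20544 --as helper`; COUNT-NEUTRAL)

WHAT IS KERNEL-CHECKED ([bookkeeping]; ONE theorem, 0 `def`, 0 `sorry`): ★★ `spineGivenEndpointR13SepCoPH_holder_of_kernels_pin_of_letters : … → SpineGivenEndpointR13SepCoPH` — THE ITEM as a
term under displayed hypotheses: ANY Stage-13 rate reading `𝔯` with the pin `hpin : (𝔯.lit F θ hP g₀ os).u3 = objectsOfRecord₁₃ F 2 θ.toStage13Params (ℓ F θ)` (K3⁷ v3 `U3PinnedKernels 𝔯 ℓ` verbatim);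
N14 ∕ N15 ∕ N16-at-exponent-β as the stubs at the guarded regime home of `𝔯` (β a LETTER); per guarded admissible tuple def-W1's FOUR kernel letters of record at the letter block `ℓ F θ` and
run offset `s F θ` plus the three letter inequalities `(ℓ F θ).Signs`, `0 < κ`, `betaPrime510 4 1 κ ≤ cr`; the K5 stubs at the guarded spine home; the spine-side representation `hx`; the N19′ edge
`h19` reading `RatesHolderAt … β`.

HONEST FRAMING.  NOT a discharge: a term of the item's type under displayed hypotheses (audit `proof.conditional`), each inhabited for no family today (K0⁷ `Record13SepCoPHInhabited`
OPEN); the four letters are BINDERS with no inhabitant (finite-volume statements of Bałaban-type shape — NOT PRINTED as such for d = 4 — and (1.21)'s existence, [Balaban1987RG1] p. 264,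
NOT proved); NE1′, NE2, NE3 at exponent β, NE7 ∕ NE7b ∕ NE7c NOT PROVED; nothing of Bałaban's asserted or instantiated; N27 COMPOSITE, NOT discharged; K3⁷ NOT claimed; route rev 25 and
the skeleton of record v3 02f6f498332fdbee UNTOUCHED; counts UNMOVED (typed 28∕28 · discharged 5∕27, A 5∕28); one finite four-torus programme at fixed `ε` — R4 closes the conditional
rung `BalabanLadder.UV` only: NOT ℝ⁴, NOT infinite volume, NOT OS, NOT a mass gap, NOT Clay.  No decl below carries a cite tag.
-/

set_option autoImplicit false

namespace Summit.QuantumFields.YangMills.Theorems.BalabanUVNodesN27SpineRecord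

open scoped Matrix.Norms.L2Operator
open Literature.MathematicalPhysics.QuantumFieldTheory.Balaban1983to89
open Literature.MathematicalPhysics.QuantumFieldTheory.Balaban1983to89.T4Continuum
open Literature.MathematicalPhysics.QuantumFieldTheory.Balaban1983to89.B12Sec2to5 (betaPrime510)
open Literature.MathematicalPhysics.QuantumFieldTheory.Balaban1983to89.Node00.U3OfKernels (objectsOfRecord₁₃)
open Literature.MathematicalPhysics.QuantumFieldTheory.Balaban1983to89.Node00.U3KernelLetters (PolLimitsExistOfRecord₁₃ WindowedNE9OfRecord₁₃ WindowedDecayOfRecord₁₃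
  WindowedStepRateOfRecord₁₃)
open T4ContinuumYM4Torus (ForSmallCouplings)
open Summit.QuantumFields.BalabanUV.T4Continuum.Spine
open YMDAG.UVSplit
open Node00 (Stage13HParams datumOfRecord₁₃CoPH U3Letters₁₁)
open Summit.QuantumFields.YangMills.BalabanUVNodes.N16HolderDefs (S_N16Holder)
open Summit.QuantumFields.YangMills.BalabanUVNodes.SpineRatesHolder (RatesHolderAt)
open Summit.QuantumFields.YangMills.Theses.BalabanUVNodes (SpineGivenEndpointR13SepCoPH)

variable (cr₁₃ : SpineReading₁₃CoPH 2) (β : ℝ) (𝔯 : RateReading₁₃CoPH 2) (ℓ : (F : T4Family) → Stage13HParams F 2 → U3Letters₁₁) (s : (F : T4Family) → Stage13HParams F 2 → ℕ)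

/-- ★★ **K3⁷ AT A KERNEL-PINNED STAGE-13 RATE READING, EVERY U3-KEYED SLOT READ OFF def-W1's FINITE-VOLUME KERNEL LETTERS OF RECORD** (`N = 2`; (Kᴸ) §2
`spine_rec13CCoPHOn_holder_of_kernels_pin_of_letters` at `Rg :=` the item's guard, through `spine_rec13CCoPHOn_iff_forall_guarded`): N22 ⟸ `PolLimitsExistOfRecord₁₃` + `WindowedNE9OfRecord₁₃`, (D4) ⟸
`PolLimitsExistOfRecord₁₃` + `WindowedDecayOfRecord₁₃` + letter inequalities, N18 ⟸ `PolLimitsExistOfRecord₁₃` (box form) + `WindowedStepRateOfRecord₁₃`, N17 eliminated, N14 ∕ N15 ∕ N16-at-β stubs, K5, `hx`,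
the N19′ edge at β — the guard reaching every θ-keyed hypothesis.  NOT a discharge: a term of the item's type under displayed hypotheses, each inhabited for no family today. [bookkeeping] -/
theorem spineGivenEndpointR13SepCoPH_holder_of_kernels_pin_of_letters
    (hpin : ∀ (F : T4Family) (θ : Stage13HParams F 2) (hP : θ.Provisos₁₃CoPH F 2) (g₀ : ℕ → ℝ) (os : List (ULoop F)),
      (𝔯.lit F θ hP g₀ os).u3 = objectsOfRecord₁₃ F 2 θ.toStage13Params (ℓ F θ))
    (h14 : S_N14 (RRec₁₃CoPHOn 𝔯 fun F θ => θ.ZhUnity F 2 ∧ θ.SlotsNondegenerate₁₃ F 2))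
    (h15 : S_N15 (RRec₁₃CoPHOn 𝔯 fun F θ => θ.ZhUnity F 2 ∧ θ.SlotsNondegenerate₁₃ F 2))
    (h16 : S_N16Holder β (RRec₁₃CoPHOn 𝔯 fun F θ => θ.ZhUnity F 2 ∧ θ.SlotsNondegenerate₁₃ F 2))
    (hs : ∀ (F : T4Family) (θ : Stage13HParams F 2), θ.Provisos₁₃CoPH F 2 → (θ.ZhUnity F 2 ∧ θ.SlotsNondegenerate₁₃ F 2) → θ.Admissible F 2 → (ℓ F θ).Signs)
    (hκ : ∀ (F : T4Family) (θ : Stage13HParams F 2), θ.Provisos₁₃CoPH F 2 → (θ.ZhUnity F 2 ∧ θ.SlotsNondegenerate₁₃ F 2) → θ.Admissible F 2 → 0 < (ℓ F θ).κ)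
    (hcr : ∀ (F : T4Family) (θ : Stage13HParams F 2), θ.Provisos₁₃CoPH F 2 → (θ.ZhUnity F 2 ∧ θ.SlotsNondegenerate₁₃ F 2) → θ.Admissible F 2 →
      betaPrime510 4 1 (ℓ F θ).κ ≤ (ℓ F θ).cr)
    (hL : ∀ (F : T4Family) (θ : Stage13HParams F 2), θ.Provisos₁₃CoPH F 2 → (θ.ZhUnity F 2 ∧ θ.SlotsNondegenerate₁₃ F 2) → θ.Admissible F 2 → PolLimitsExistOfRecord₁₃ F 2 θ.toStage13Params)
    (h9 : ∀ (F : T4Family) (θ : Stage13HParams F 2), θ.Provisos₁₃CoPH F 2 → (θ.ZhUnity F 2 ∧ θ.SlotsNondegenerate₁₃ F 2) → θ.Admissible F 2 →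
      WindowedNE9OfRecord₁₃ F 2 θ.toStage13Params (ℓ F θ).κ (ℓ F θ).moduli)
    (hW : ∀ (F : T4Family) (θ : Stage13HParams F 2), θ.Provisos₁₃CoPH F 2 → (θ.ZhUnity F 2 ∧ θ.SlotsNondegenerate₁₃ F 2) → θ.Admissible F 2 →
      WindowedDecayOfRecord₁₃ F 2 θ.toStage13Params 0 1 (ℓ F θ).κ)
    (hS : ∀ (F : T4Family) (θ : Stage13HParams F 2), θ.Provisos₁₃CoPH F 2 → (θ.ZhUnity F 2 ∧ θ.SlotsNondegenerate₁₃ F 2) → θ.Admissible F 2 →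
      WindowedStepRateOfRecord₁₃ F 2 θ.toStage13Params (s F θ) (ℓ F θ).κ (ℓ F θ).θ₅ ((ℓ F θ).C₅ * (ℓ F θ).θ₅))
    (h20 : S_N20 (SRec₁₃CoPHOn cr₁₃ fun F θ => θ.ZhUnity F 2 ∧ θ.SlotsNondegenerate₁₃ F 2)) (h21 : S_N21 (SRec₁₃CoPHOn cr₁₃ fun F θ => θ.ZhUnity F 2 ∧ θ.SlotsNondegenerate₁₃ F 2))
    (hx : ∀ (F : T4Family) (θ : Stage13HParams F 2) (hP : θ.Provisos₁₃CoPH F 2), (θ.ZhUnity F 2 ∧ θ.SlotsNondegenerate₁₃ F 2) → θ.Admissible F 2 →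
      B16.EndStatementBPrinted (datumOfRecord₁₃CoPH F 2 θ hP).C → DagBinding.EndpointExistence (datumOfRecord₁₃CoPH F 2 θ hP).C.toB12 →
        ForSmallCouplings (datumOfRecord₁₃CoPH F 2 θ hP) fun g₀ => ∀ os : List (ULoop F),
          0 < (cr₁₃ F θ hP g₀ os).l₀ ∧ 0 < (cr₁₃ F θ hP g₀ os).vol ∧
          (∀ (K : ℕ) (t : ℝ), |t| ≤ (cr₁₃ F θ hP g₀ os).l₀ →
            T4GenFunBounds.schemeZ ((datumOfRecord₁₃CoPH F 2 θ hP).scheme g₀) os ((cr₁₃ F θ hP g₀ os).K₀ + K) t =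
              ∑ τ ∈ (cr₁₃ F θ hP g₀ os).T K, (cr₁₃ F θ hP g₀ os).A K t τ) ∧
          (∀ (K : ℕ) (t : ℝ), |t| ≤ (cr₁₃ F θ hP g₀ os).l₀ →
            T4GenFunBounds.schemeZ ((datumOfRecord₁₃CoPH F 2 θ hP).scheme g₀) os ((cr₁₃ F θ hP g₀ os).K₀ + K + 1) t =
              ∑ τ ∈ (cr₁₃ F θ hP g₀ os).T K, (cr₁₃ F θ hP g₀ os).B K t τ))
    (h19 : ∀ (F : T4Family) (θ : Stage13HParams F 2) (hP : θ.Provisos₁₃CoPH F 2), (θ.ZhUnity F 2 ∧ θ.SlotsNondegenerate₁₃ F 2) → θ.Admissible F 2 → ∀ (g₀ : ℕ → ℝ) (os : List (ULoop F)),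
      (∀ k : ℕ, RatesHolderAt (datumOfRecord₁₃CoPH F 2 θ hP) (rateCarriersOfRecord₁₃CoPH 𝔯 F θ hP g₀ os k) β) → letI := (cr₁₃ F θ hP g₀ os).dec
        ∃ δ : ℕ → ℝ, NE7.Core (cr₁₃ F θ hP g₀ os).l₀ (cr₁₃ F θ hP g₀ os).vol (cr₁₃ F θ hP g₀ os).T (cr₁₃ F θ hP g₀ os).Bad
          (fun K t τ => (cr₁₃ F θ hP g₀ os).A K t τ - (cr₁₃ F θ hP g₀ os).shA K t τ) (fun K t τ => (cr₁₃ F θ hP g₀ os).B K t τ - (cr₁₃ F θ hP g₀ os).shB K t τ) δ ∧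
          Summable δ) :
    SpineGivenEndpointR13SepCoPH :=
  fun F θ hP hG hθ _ _ =>
    (spine_rec13CCoPHOn_iff_forall_guarded fun F θ => θ.ZhUnity F 2 ∧ θ.SlotsNondegenerate₁₃ F 2).mp
      (spine_rec13CCoPHOn_holder_of_kernels_pin_of_letters cr₁₃ β 𝔯 (fun F θ => θ.ZhUnity F 2 ∧ θ.SlotsNondegenerate₁₃ F 2) ℓ s hpin h14 h15 h16 hs hκ hcr hL h9 hW hS h20 h21 hx h19)
      F θ hP.toCore hG hθ

end Summit.QuantumFields.YangMills.Theorems.BalabanUVNodesN27SpineRecord
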